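/-
Copyright (c) 2026 the pub-hodgecm-mathlib formalisation cell (harness21).  Prover seat hodgecm-mathlib-K2E4-p08 (g2), Track B «K2-LIT» ∕ h413,
‹S› ROAD J brick J2♯ (K2E3-plan (g1) BATCH #3), generic layer: Kottwitz's EP glue WITH THE VALUE OF `f_EP` ON `K ⊓ K′ ⊓ I`.  2026-09-03.
-/
import Literature.NumberTheory.Rogawski1990.RankOneEulerPoincareGlue   -- ★ (R2-g) B-p14: `isLocSmooth_epCombination`, `classOrbitalIntegral_epCombination_eq{_of_compactSpace}`
import HarnessLib

/-!
# [Kottwitz1988 §2; Rogawski1990 §12.6, §8.1 p. 117] The Euler–Poincaré glue WITH THE VALUE of `f_EP` at the elements of `K ⊓ K′ ⊓ I` — road J brick J2♯, generic layer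

Topic `NumberTheory/Rogawski1990`; namespace `Literature.NumberTheory.Rogawski1990`.  KERNEL LANE: theorems only (no `def`, no instance, no notation, no named fact, no `sorry`).
Cell `pub/hodgecm-mathlib` (D-0151), crux H413 = `stmt-HodgeConjecture-24833`, Track B «K2-LIT», E3 junction socket ‹S› `sig_K2E3SingularTransferSigned`, ROAD J (K2E3-plan (g1)
BATCH #3, 2026-09-03): the compact-side dress of Track A's ★ S1 junction (★ `LocalTransferCompactSideJunctionCM`) multiplies the rank-one EP function `f` of the letter ★ (R2)
`RankOneEulerPoincareNonsplit` by a constant and reads the transfer AT THE CENTRE `ε_H = (a·1₂, u)`, so road J needs `f(a·1₂)` — which the `∃ f` of the letter hides.  The ★ glue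
`exists_isLocSmooth_classOrbitalIntegral_eq_one_zero_of_relations` BUILDS `f = ν(K)⁻¹𝟙_K + ν(K′)⁻¹𝟙_{K′} − ν(I)⁻¹𝟙_I` explicitly; THIS FILE re-runs it keeping the witness and adds:

* `epCombination_apply_of_mem` — at every `z ∈ K ⊓ K′ ⊓ I` (e.g. the central unit scalars, which lie in every lattice stabiliser) `f z = ν(K)⁻¹ + ν(K′)⁻¹ − ν(I)⁻¹`;
* **`exists_isLocSmooth_classOrbitalIntegral_eq_one_zero_and_apply_of_relations`** — the ★ glue's hypotheses ((E) at the elliptic regular classes, (N) at the others) ⇒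
  `∃ f ∈ C_c^∞` with the two orbital-integral properties of (R2) AND `∀ z ∈ K ⊓ K′ ⊓ I, f z = ν(K)⁻¹ + ν(K′)⁻¹ − ν(I)⁻¹`;
* `inv_add_inv_sub_inv_neg_of_lt` + **`exists_isLocSmooth_classOrbitalIntegral_eq_one_zero_and_apply_neg_of_relations`** — if moreover `ν(K)⁻¹ + ν(K′)⁻¹ < ν(I)⁻¹` (the tree
  picture: `I = K ⊓ K′` of index `q + 1 ≥ 3` in both vertex stabilisers, resp. `(K, Ĩ, Ĩ⁺)` with `[Ĩ : Ĩ⁺] = 2`, `[K : Ĩ⁺] = q + 1`), then `∃ r > 0`, `f z = −r` on `K ⊓ K′ ⊓ I`: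
  Kottwitz's value `f_EP(1) = μ_EP < 0` for a rank-one group — print's sign `Γ₁^{I(j)} = (−1)^{q(I(j))} d(j)⁻¹` with `q = 1` [Rogawski1990 p. 117; Rogawski1981].
The per-place discharge of the two extra hypotheses (unit scalars in `K ⊓ K′ ⊓ I`; the index inequality) through the (R2) tower (★ `…UnramifiedAll`, ★ `…RamifiedPackage`,
★ `…OfTreeActions`) is the remaining part of J2♯ (`RankOneEulerPoincareNonsplitWithCentralValue`).
HONEST LABEL: HC_CM is proved only modulo the 7 printed citations (2 remaining named inputs: hLiu418 = stmt-HodgeConjecture-24832, h413 = stmt-HodgeConjecture-24833) until rung 0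
closes; this file discharges no count.

## References
* [Kottwitz1988] R. E. Kottwitz, *Tamagawa numbers*, Ann. of Math. 127 (1988) 629–646: §1 (compatible measures, `d(j)`), §2 Theorem 2 (the EP function).
* [Rogawski1990] J. D. Rogawski, *Automorphic Representations of Unitary Groups in Three Variables*, Ann. of Math. Stud. 123 (1990): §12.6 p. 174; §8.1 p. 117.
* [Rogawski1981ApplicationBuildingOrbitalIntegrals] J. D. Rogawski, *An application of the building to orbital integrals*, Compositio Math. 42 (1981) (`Γ₁ = (−1)^q d(St)⁻¹`).
* [Serre1980Trees] J.-P. Serre, *Trees* (1980), II.1.1.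
-/

set_option autoImplicit false

noncomputable section

open NumberField IsDedekindDomain MeasureTheory Measure
open Literature.NumberTheory.Automorphic
open scoped Matrix MatrixGroups ENNReal

namespace Literature.NumberTheory.Rogawski1990

/-! ## §1 The value of the three-term combination on `K ⊓ K′ ⊓ I`; the sign from the index inequality -/

section Value

variable {G : Type*} [Group G]

/-- On `K ⊓ K′ ⊓ I` the three-term combination `a·𝟙_K + b·𝟙_{K′} − c·𝟙_I` takes the value `a + b − c`. [cite: Kottwitz1988, §2 Theorem 2] -/
theorem epCombination_apply_of_mem (K K' I : Subgroup G) (a b c : ℂ) {z : G} (hK : z ∈ K) (hK' : z ∈ K') (hI : z ∈ I) :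
    a * (K : Set G).indicator (fun _ => (1 : ℂ)) z + b * (K' : Set G).indicator (fun _ => (1 : ℂ)) z -
      c * (I : Set G).indicator (fun _ => (1 : ℂ)) z = a + b - c := by
  rw [Set.indicator_of_mem (show z ∈ (K : Set G) from hK), Set.indicator_of_mem (show z ∈ (K' : Set G) from hK'),
    Set.indicator_of_mem (show z ∈ (I : Set G) from hI), mul_one, mul_one, mul_one]

/-- **Sign bookkeeping**: for real `x, y, w` with `x + y < w`, `x + y − w = −r` with `r = w − x − y > 0` (cast to `ℂ`). [cite: Rogawski1990, §8.1 p. 117] -/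
theorem inv_add_inv_sub_inv_neg_of_lt {x y w : ℝ} (h : x + y < w) :
    ∃ r : ℝ, 0 < r ∧ ((x : ℂ) + (y : ℂ) - (w : ℂ)) = -(r : ℂ) :=
  ⟨w - x - y, by linarith, by push_cast; ring⟩

end Value

/-! ## §2 The glue with the value (any rank `N`, any hermitian `H` with `det H ≠ 0`) -/

section CM

variable (L : Type) [Field L] [NumberField L] [IsCMField L] (N : ℕ) (H : Matrix (Fin N) (Fin N) L)
  (v : HeightOneSpectrum (𝓞 ↥(maximalRealSubfield L)))
  [MeasurableSpace ((UnitaryGroup.cmDatum L N H).Local v)] [BorelSpace ((UnitaryGroup.cmDatum L N H).Local v)]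
  [∀ γ : (UnitaryGroup.cmDatum L N H).Local v,
    MeasurableSpace (((UnitaryGroup.cmDatum L N H).Local v) ⧸ Subgroup.centralizer ({γ} : Set ((UnitaryGroup.cmDatum L N H).Local v)))]
  [∀ γ : (UnitaryGroup.cmDatum L N H).Local v,
    BorelSpace (((UnitaryGroup.cmDatum L N H).Local v) ⧸ Subgroup.centralizer ({γ} : Set ((UnitaryGroup.cmDatum L N H).Local v)))]
  (ν : Measure ((UnitaryGroup.cmDatum L N H).Local v)) [IsHaarMeasure ν] [ν.IsMulRightInvariant]

/-- **(R2-g WITH VALUE).**  Under the ★ glue's hypotheses — `K, K′, I` compact open, (E) at every elliptic regular class, (N) at every non-elliptic regular class — the EXPLICIT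
`f_EP := ν(K)⁻¹𝟙_K + ν(K′)⁻¹𝟙_{K′} − ν(I)⁻¹𝟙_I ∈ C_c^∞` has `Φ(⟦γ⟧, f_EP) = 1` ∕ `0` at the elliptic ∕ non-elliptic regular classes (★ glue, token for token) AND takes the value
`ν(K)⁻¹ + ν(K′)⁻¹ − ν(I)⁻¹` at every `z ∈ K ⊓ K′ ⊓ I`. [cite: Kottwitz1988, §2 Theorem 2] [cite: Rogawski1990, §12.6 p. 174; §8.1 p. 117] -/
theorem exists_isLocSmooth_classOrbitalIntegral_eq_one_zero_and_apply_of_relations (hH : (H.map (cmConjRingHom L))ᵀ = H) (hdet : H.det ≠ 0)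
    {m : OrbitalMeasureFamily ((UnitaryGroup.cmDatum L N H).Local v)}
    (hm : m.IsCanonical (fun γ' => IsRegularElt (γ'.val : GL (Fin N) (UnitaryGroup.LocalRing L v))) ν)
    (K K' I : Subgroup ((UnitaryGroup.cmDatum L N H).Local v))
    (hKo : IsOpen (K : Set ((UnitaryGroup.cmDatum L N H).Local v))) (hKc : IsCompact (K : Set ((UnitaryGroup.cmDatum L N H).Local v)))
    (hK'o : IsOpen (K' : Set ((UnitaryGroup.cmDatum L N H).Local v))) (hK'c : IsCompact (K' : Set ((UnitaryGroup.cmDatum L N H).Local v)))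
    (hIo : IsOpen (I : Set ((UnitaryGroup.cmDatum L N H).Local v))) (hIc : IsCompact (I : Set ((UnitaryGroup.cmDatum L N H).Local v)))
    (hE : ∀ γ : (UnitaryGroup.cmDatum L N H).Local v, IsRegularElt (γ.val : GL (Fin N) (UnitaryGroup.LocalRing L v)) →
      CompactSpace (Subgroup.centralizer ({γ} : Set ((UnitaryGroup.cmDatum L N H).Local v))) →
      Nat.card (MulAction.fixedBy ((UnitaryGroup.cmDatum L N H).Local v ⧸ K) γ) + Nat.card (MulAction.fixedBy ((UnitaryGroup.cmDatum L N H).Local v ⧸ K') γ) =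
        Nat.card (MulAction.fixedBy ((UnitaryGroup.cmDatum L N H).Local v ⧸ I) γ) + 1)
    (hN : ∀ γ : (UnitaryGroup.cmDatum L N H).Local v, IsRegularElt (γ.val : GL (Fin N) (UnitaryGroup.LocalRing L v)) →
      ¬ CompactSpace (Subgroup.centralizer ({γ} : Set ((UnitaryGroup.cmDatum L N H).Local v))) →
      (((ν K).toReal : ℂ))⁻¹ * classOrbitalIntegral m ((K : Set ((UnitaryGroup.cmDatum L N H).Local v)).indicator fun _ => (1 : ℂ)) (ConjClasses.mk γ) +
        (((ν K').toReal : ℂ))⁻¹ * classOrbitalIntegral m ((K' : Set ((UnitaryGroup.cmDatum L N H).Local v)).indicator fun _ => (1 : ℂ)) (ConjClasses.mk γ) -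
        (((ν I).toReal : ℂ))⁻¹ * classOrbitalIntegral m ((I : Set ((UnitaryGroup.cmDatum L N H).Local v)).indicator fun _ => (1 : ℂ)) (ConjClasses.mk γ) = 0) :
    ∃ f : (UnitaryGroup.cmDatum L N H).Local v → ℂ, IsLocSmooth f ∧
      (∀ γ : (UnitaryGroup.cmDatum L N H).Local v, IsRegularElt (γ.val : GL (Fin N) (UnitaryGroup.LocalRing L v)) →
        CompactSpace (Subgroup.centralizer ({γ} : Set ((UnitaryGroup.cmDatum L N H).Local v))) → classOrbitalIntegral m f (ConjClasses.mk γ) = 1) ∧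
      (∀ γ : (UnitaryGroup.cmDatum L N H).Local v, IsRegularElt (γ.val : GL (Fin N) (UnitaryGroup.LocalRing L v)) →
        ¬ CompactSpace (Subgroup.centralizer ({γ} : Set ((UnitaryGroup.cmDatum L N H).Local v))) → classOrbitalIntegral m f (ConjClasses.mk γ) = 0) ∧
      (∀ z : (UnitaryGroup.cmDatum L N H).Local v, z ∈ K → z ∈ K' → z ∈ I →
        f z = (((ν K).toReal : ℂ))⁻¹ + (((ν K').toReal : ℂ))⁻¹ - (((ν I).toReal : ℂ))⁻¹) := by
  refine ⟨fun g => (((ν K).toReal : ℂ))⁻¹ * (K : Set ((UnitaryGroup.cmDatum L N H).Local v)).indicator (fun _ => (1 : ℂ)) g +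
      (((ν K').toReal : ℂ))⁻¹ * (K' : Set ((UnitaryGroup.cmDatum L N H).Local v)).indicator (fun _ => (1 : ℂ)) g -
      (((ν I).toReal : ℂ))⁻¹ * (I : Set ((UnitaryGroup.cmDatum L N H).Local v)).indicator (fun _ => (1 : ℂ)) g,
    isLocSmooth_epCombination K K' I hKo hKc hK'o hK'c hIo hIc _ _ _, fun γ hreg hc => ?_, fun γ hreg hnc => ?_,
    fun z hzK hzK' hzI => epCombination_apply_of_mem K K' I _ _ _ hzK hzK' hzI⟩
  · rw [classOrbitalIntegral_epCombination_eq_of_compactSpace L N H v ν hH hdet hm K K' I hKo hKc hK'o hK'c hIo hIc γ hreg]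
    have h := hE γ hreg hc
    have h' : (Nat.card (MulAction.fixedBy ((UnitaryGroup.cmDatum L N H).Local v ⧸ K) γ) : ℂ) +
        (Nat.card (MulAction.fixedBy ((UnitaryGroup.cmDatum L N H).Local v ⧸ K') γ) : ℂ) =
        (Nat.card (MulAction.fixedBy ((UnitaryGroup.cmDatum L N H).Local v ⧸ I) γ) : ℂ) + 1 := by exact_mod_cast h
    rw [h', add_sub_cancel_left]
  · rw [classOrbitalIntegral_epCombination_eq L N H v hH hdet hm.isAdmissibleOn K K' I hKo hKc hK'o hK'c hIo hIc _ _ _ γ hreg]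
    exact hN γ hreg hnc

/-- **(R2-g WITH NEGATIVE CENTRAL VALUE).**  If moreover `ν(K)⁻¹ + ν(K′)⁻¹ < ν(I)⁻¹` — in the tree: `I` has index `≥ 3` in `K` and `≥ 2` in `K′` — then the EP function of
the glue is, on `K ⊓ K′ ⊓ I`, a NEGATIVE real constant `−r`: Kottwitz's `μ_EP < 0` ∕ print's identity-germ sign `(−1)^{q}`, `q = 1` for a rank-one group.
[cite: Kottwitz1988, §2 Theorem 2] [cite: Rogawski1990, §8.1 p. 117] [cite: Rogawski1981ApplicationBuildingOrbitalIntegrals] -/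
theorem exists_isLocSmooth_classOrbitalIntegral_eq_one_zero_and_apply_neg_of_relations (hH : (H.map (cmConjRingHom L))ᵀ = H) (hdet : H.det ≠ 0)
    {m : OrbitalMeasureFamily ((UnitaryGroup.cmDatum L N H).Local v)}
    (hm : m.IsCanonical (fun γ' => IsRegularElt (γ'.val : GL (Fin N) (UnitaryGroup.LocalRing L v))) ν)
    (K K' I : Subgroup ((UnitaryGroup.cmDatum L N H).Local v))
    (hKo : IsOpen (K : Set ((UnitaryGroup.cmDatum L N H).Local v))) (hKc : IsCompact (K : Set ((UnitaryGroup.cmDatum L N H).Local v)))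
    (hK'o : IsOpen (K' : Set ((UnitaryGroup.cmDatum L N H).Local v))) (hK'c : IsCompact (K' : Set ((UnitaryGroup.cmDatum L N H).Local v)))
    (hIo : IsOpen (I : Set ((UnitaryGroup.cmDatum L N H).Local v))) (hIc : IsCompact (I : Set ((UnitaryGroup.cmDatum L N H).Local v)))
    (hE : ∀ γ : (UnitaryGroup.cmDatum L N H).Local v, IsRegularElt (γ.val : GL (Fin N) (UnitaryGroup.LocalRing L v)) →
      CompactSpace (Subgroup.centralizer ({γ} : Set ((UnitaryGroup.cmDatum L N H).Local v))) →
      Nat.card (MulAction.fixedBy ((UnitaryGroup.cmDatum L N H).Local v ⧸ K) γ) + Nat.card (MulAction.fixedBy ((UnitaryGroup.cmDatum L N H).Local v ⧸ K') γ) =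
        Nat.card (MulAction.fixedBy ((UnitaryGroup.cmDatum L N H).Local v ⧸ I) γ) + 1)
    (hN : ∀ γ : (UnitaryGroup.cmDatum L N H).Local v, IsRegularElt (γ.val : GL (Fin N) (UnitaryGroup.LocalRing L v)) →
      ¬ CompactSpace (Subgroup.centralizer ({γ} : Set ((UnitaryGroup.cmDatum L N H).Local v))) →
      (((ν K).toReal : ℂ))⁻¹ * classOrbitalIntegral m ((K : Set ((UnitaryGroup.cmDatum L N H).Local v)).indicator fun _ => (1 : ℂ)) (ConjClasses.mk γ) +
        (((ν K').toReal : ℂ))⁻¹ * classOrbitalIntegral m ((K' : Set ((UnitaryGroup.cmDatum L N H).Local v)).indicator fun _ => (1 : ℂ)) (ConjClasses.mk γ) -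
        (((ν I).toReal : ℂ))⁻¹ * classOrbitalIntegral m ((I : Set ((UnitaryGroup.cmDatum L N H).Local v)).indicator fun _ => (1 : ℂ)) (ConjClasses.mk γ) = 0)
    (hidx : (ν K).toReal⁻¹ + (ν K').toReal⁻¹ < (ν I).toReal⁻¹) :
    ∃ f : (UnitaryGroup.cmDatum L N H).Local v → ℂ, IsLocSmooth f ∧
      (∀ γ : (UnitaryGroup.cmDatum L N H).Local v, IsRegularElt (γ.val : GL (Fin N) (UnitaryGroup.LocalRing L v)) →
        CompactSpace (Subgroup.centralizer ({γ} : Set ((UnitaryGroup.cmDatum L N H).Local v))) → classOrbitalIntegral m f (ConjClasses.mk γ) = 1) ∧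
      (∀ γ : (UnitaryGroup.cmDatum L N H).Local v, IsRegularElt (γ.val : GL (Fin N) (UnitaryGroup.LocalRing L v)) →
        ¬ CompactSpace (Subgroup.centralizer ({γ} : Set ((UnitaryGroup.cmDatum L N H).Local v))) → classOrbitalIntegral m f (ConjClasses.mk γ) = 0) ∧
      ∃ r : ℝ, 0 < r ∧ ∀ z : (UnitaryGroup.cmDatum L N H).Local v, z ∈ K → z ∈ K' → z ∈ I → f z = -(r : ℂ) := by
  obtain ⟨f, hf, h1, h0, hval⟩ := exists_isLocSmooth_classOrbitalIntegral_eq_one_zero_and_apply_of_relations L N H v ν hH hdet hm K K' I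
    hKo hKc hK'o hK'c hIo hIc hE hN
  obtain ⟨r, hr, hrw⟩ := inv_add_inv_sub_inv_neg_of_lt hidx
  refine ⟨f, hf, h1, h0, r, hr, fun z hzK hzK' hzI => ?_⟩
  rw [hval z hzK hzK' hzI, ← hrw]
  push_cast
  ring

end CM

end Literature.NumberTheory.Rogawski1990

end
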